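import Literature.MathematicalPhysics.QuantumFieldTheory.BalabanImbrieJaffe1984to88.BIJ88Sect4Statements

/-!
# `BalabanImbrieJaffe1984to88.BIJ88Regularity286` — T. Bałaban, J. Imbrie, A. Jaffe, *Effective action and cluster properties
of the abelian Higgs model*, Commun. Math. Phys. **114** (1988) 257–315 [BalabanImbrieJaffe1988], Sect. 5.6 p. 286: the
REGULARITY CONDITION on the modified background field `ũ_{k+1}` (the induction hypothesis (4.3) recovered at step `k+1`) —
TYPED as a predicate over r18's `BIJ88Sect4Statements.Smooth43`, with the two printed mechanisms PROVED

statement-level skeleton of published theorems with citation tags; proofs where landed; nothing here is a claim about the Yang–Mills mass gap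

PDF held: `paper:balaban1988-cmp114-bij-abelian-higgs-effective-action` (journal page = PDF page + 256).  p. 286 [PDF 30] read as an
image by this seat (g4png ×2 render `HOME/lit-balaban-r16/renders/cmp114/original-p030-x2.png`).

CITATION HEADER (lean-in-tree rule).  Part of the lit-balaban TYPED SKELETON (HOME `run/shared/lean/pub/lit-balaban/`): row
`C2.Claim@286` of `HOME/lit-balaban-r16/ROWS-C2-part2.md` (unit `lit-balaban-r16`, fold owner of C2 Sect. 5, gen 3).

THE PRINTED TEXT, p. 286 [PDF 30], verbatim.  *"We need to check the regularity condition on ũ_{k+1}. It states that there exists a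
gauge transformation ũ_{k+1} → ũ^λ_{k+1} in each r(e_k)-cube □ ⊂ Λ̄₁^{(k)} such that ũ^λ_{k+1} = exp(ie_kηA^λ) with |A^λ|, |∂A^λ|,
|∂*A^λ| ≦ cp(e_k)r(e_k). In Λ̄₁^{(k)*c} we have ũ_{k+1} = u_k, so the condition follows from the induction hypothesis (4.3).
We verify the bound by first checking it for u_k, then noticing that all the operations changing u_k into ũ_{k+1} did not destroy
the bound."* … *"Note that Q^{s*}_k e^{ie_k∂λ} is a gauge transformation (generated by Q′*_k λ), so we can delete it from u_k."* …
*"The first operation we performed was a translation, which of course does not spoil the regularity of u_k. We then made a gauge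
transformation and removed the small kernel w₁. The gauge transformation does not change the regularity, and ∂w₁, ∂*w₁ are
small, so the bounds remain valid. … Thus removing θ_kH_{k,loc}A^{(k)} does not spoil the regularity, and ũ_{k+1} satisfies the
regularity condition. In an analogous fashion we can check that the j-th regularity condition for r(e_k)-cubes remains valid."*

TYPED READING.  The condition quoted is (4.3) p. 274 at `j = k`, lattice spacing `ζ = η` — r18's `BIJ88Sect4Statements.Smooth43
e_k η c p(e_k) r(e_k) X B Pl u` for ONE cube (sites `X`, bonds `B`, plaquettes `Pl`), a ℂ-valued bond field `u` on the torus
carrier of `Setup`, `∂ = LatticeFieldCalculus.curl η⁻¹`, `∂* = diverg η⁻¹`, gauge transformation `BIJ88Sect3Statements.gaugeU`.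
Here the `r(e_k)`-cubes are given, as in `BIJ88Sect5StatementsPart3.smallFieldRegion`, by a labelling `cube : Site → γ` (the
cube of `x` is its label); the cube with label `g` has sites `cubeSites cube g`, bonds `starB` (both endpoints in it) and
plaquettes `starP` (all four corners in it) — the p. 266 conventions `X*`, `X**`.  `Regular286 cube G …  u` := (4.3) holds for
`u` on every cube whose label lies in `G` (the labels of the cubes `□ ⊂ Λ̄₁^{(k)}`); the CLAIM of the row is `Regular286 … ũ_{k+1}`
for the paper's `ũ_{k+1}` ((5.3.3)/(5.5.13)/(5.6.1) region by region; `BIJ88Sect5StatementsPart3.uTilde561` in `Λ̄₅^{(k)*}`).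
PROVED (kernel-checked, standard axioms): `gaugeU_gaugeU` (gauge transformations compose additively), `smooth43_congr`
((4.3) on a cube sees `u` only on the cube's bonds), `smooth43_gaugeU_iff` / `regular286_gaugeU_iff` (*"The gauge transformation
does not change the regularity"*; *"… is a gauge transformation …, so we can delete it from u_k"*), and `regular286_of_eqOn`
(*"In Λ̄₁^{(k)*c} we have ũ_{k+1} = u_k, so the condition follows from the induction hypothesis (4.3)"*: on every family of cubes on
whose bonds `ũ_{k+1} = u_k`, (4.3) for `u_k` gives (4.3) for `ũ_{k+1}`).
NOT HERE (honest scope): the bounds on the kernels `𝒟_{k,loc}`, `H_{k,loc}`, `w₁`, `θ_k` ((5.6.3)–(5.6.5), [2] Sect. 4) that carry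
the regularity through the translations inside `Λ̄₁^{(k)*}` — no bound is asserted; (5.6.5) itself is
`BIJ88Sect5StatementsPart3.eq565`.  No `sorry`, no axiom, no `Prop` placeholder beyond the predicate `Regular286`.
-/

namespace Literature.MathematicalPhysics.QuantumFieldTheory.BalabanImbrieJaffe1984to88.BIJ88Regularity286

open Literature.MathematicalPhysics.QuantumFieldTheory.Balaban1983to89
open BIJ88Sect3Statements BIJ88Sect4Statements
open Complex

noncomputable section

variable {P : Params} {j : ℕ}

/-! ## Gauge transformations compose; (4.3) on a cube is local and gauge invariant -/

/-- Gauge transformations of a bond field compose additively: `(u^μ)^λ = u^{λ+μ}` (`gaugeU lam u b = e^{iλ(b₋)} u(b) e^{−iλ(b₊)}`).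
[cite: BalabanImbrieJaffe1988, (4.3) p.274] -/
theorem gaugeU_gaugeU (lam mu : Balaban1983to89.Site P j → ℝ) (u : PBond P j → ℂ) :
    gaugeU lam (gaugeU mu u) = gaugeU (fun x => lam x + mu x) u := by
  funext b
  simp only [gaugeU]
  push_cast
  rw [show ((lam b.src : ℂ) + mu b.src) * I = lam b.src * I + mu b.src * I by ring,
    show -(((lam b.tgt : ℂ) + mu b.tgt) * I) = -(lam b.tgt * I) + -(mu b.tgt * I) by ring,
    Complex.exp_add, Complex.exp_add]
  ring

/-- The trivial gauge transformation `λ = 0` does nothing. [cite: BalabanImbrieJaffe1988, (4.3) p.274] -/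
theorem gaugeU_zero (u : PBond P j → ℂ) : gaugeU (fun _ => (0 : ℝ)) u = u := by
  funext b
  simp [gaugeU]

/-- (4.3) on a cube depends on the field only through its values on the cube's bonds `B`.
[cite: BalabanImbrieJaffe1988, (4.3) p.274] -/
theorem smooth43_congr {ej ζ c pej rej : ℝ} {X : Finset (Balaban1983to89.Site P j)} {B : Finset (PBond P j)}
    {Pl : Finset (Plaq P j)} {u u' : PBond P j → ℂ} (h : ∀ b ∈ B, u b = u' b) :
    Smooth43 ej ζ c pej rej X B Pl u ↔ Smooth43 ej ζ c pej rej X B Pl u' := by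
  have key : ∀ (lam : Balaban1983to89.Site P j → ℝ), ∀ b ∈ B, gaugeU lam u b = gaugeU lam u' b := fun lam b hb => by
    simp only [gaugeU, h b hb]
  constructor
  · rintro ⟨lam, A, h1, h2, h3, h4⟩
    exact ⟨lam, A, fun b hb => (key lam b hb) ▸ h1 b hb, h2, h3, h4⟩
  · rintro ⟨lam, A, h1, h2, h3, h4⟩
    exact ⟨lam, A, fun b hb => (key lam b hb).symm ▸ h1 b hb, h2, h3, h4⟩

/-- **(4.3) is gauge invariant** — p. 286: *"The gauge transformation does not change the regularity"*; also *"Note that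
Q^{s*}_k e^{ie_k∂λ} is a gauge transformation (generated by Q′*_kλ), so we can delete it from u_k."*  For every gauge function `μ`,
`u^μ` satisfies (4.3) on a cube iff `u` does (the gauge function of the condition shifts by `∓μ`).
[cite: BalabanImbrieJaffe1988, (4.3) p.286] -/
theorem smooth43_gaugeU_iff (ej ζ c pej rej : ℝ) (X : Finset (Balaban1983to89.Site P j)) (B : Finset (PBond P j))
    (Pl : Finset (Plaq P j)) (mu : Balaban1983to89.Site P j → ℝ) (u : PBond P j → ℂ) :
    Smooth43 ej ζ c pej rej X B Pl (gaugeU mu u) ↔ Smooth43 ej ζ c pej rej X B Pl u := by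
  constructor
  · rintro ⟨lam, A, h1, h2, h3, h4⟩
    refine ⟨fun x => lam x + mu x, A, fun b hb => ?_, h2, h3, h4⟩
    rw [← gaugeU_gaugeU]
    exact h1 b hb
  · rintro ⟨lam, A, h1, h2, h3, h4⟩
    refine ⟨fun x => lam x - mu x, A, fun b hb => ?_, h2, h3, h4⟩
    have e : gaugeU (fun x => lam x - mu x) (gaugeU mu u) = gaugeU lam u := by
      rw [gaugeU_gaugeU]
      congr 1
      funext x
      ring
    rw [e]
    exact h1 b hb

/-- (4.3) is monotone in the constant `c` (for `p(e_j), r(e_j) ≥ 0`): a cube regular with constant `c` is regular with any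
`c' ≥ c` — the form in which p. 275 *"We have incorporated … into the constant c"* is used. [cite: BalabanImbrieJaffe1988, (4.3) p.274] -/
theorem smooth43_mono {ej ζ c c' pej rej : ℝ} (hc : c ≤ c') (hp : 0 ≤ pej) (hr : 0 ≤ rej)
    {X : Finset (Balaban1983to89.Site P j)} {B : Finset (PBond P j)} {Pl : Finset (Plaq P j)} {u : PBond P j → ℂ}
    (h : Smooth43 ej ζ c pej rej X B Pl u) : Smooth43 ej ζ c' pej rej X B Pl u := by
  obtain ⟨lam, A, h1, h2, h3, h4⟩ := h
  have hcc : c * pej * rej ≤ c' * pej * rej :=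
    mul_le_mul_of_nonneg_right (mul_le_mul_of_nonneg_right hc hp) hr
  exact ⟨lam, A, h1, fun b hb => (h2 b hb).trans hcc, fun p hp' => (h3 p hp').trans hcc, fun x hx => (h4 x hx).trans hcc⟩

/-! ## The r(e_k)-cubes and the regularity condition of p. 286 -/

open Classical in
/-- The sites of the `r(e_k)`-cube with label `g` (cubes given by a labelling `cube : site ↦ label`, as in
`BIJ88Sect5StatementsPart3.smallFieldRegion`). [cite: BalabanImbrieJaffe1988, (5.2.6) p.279] -/
def cubeSites {γ : Type*} (cube : Balaban1983to89.Site P j → γ) (g : γ) : Finset (Balaban1983to89.Site P j) :=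
  Finset.univ.filter fun x => cube x = g

/-- membership in `cubeSites`. [cite: BalabanImbrieJaffe1988, (5.2.6) p.279] -/
theorem mem_cubeSites {γ : Type*} (cube : Balaban1983to89.Site P j → γ) (g : γ) (x : Balaban1983to89.Site P j) :
    x ∈ cubeSites cube g ↔ cube x = g := by
  classical
  simp [cubeSites]

/-- **The regularity condition of p. 286** (= (4.3) p. 274 at `j = k`, `ζ = η`), verbatim: *"It states that there exists a gauge
transformation ũ_{k+1} → ũ^λ_{k+1} in each r(e_k)-cube □ ⊂ Λ̄₁^{(k)} such that ũ^λ_{k+1} = exp(ie_kηA^λ) with |A^λ|, |∂A^λ|, |∂*A^λ| ≦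
cp(e_k)r(e_k)."* — for a bond field `u` on the torus carrier: (4.3) (`BIJ88Sect4Statements.Smooth43 ek η c pek rek`) holds on every
cube whose label lies in `G` (the labels of the `r(e_k)`-cubes `□ ⊂ Λ̄₁^{(k)}`), the cube entering with its sites, its bonds `□*`
(`starB`) and its plaquettes `□**` (`starP`).  The row's CLAIM is this predicate AT the paper's `ũ_{k+1}`.
[cite: BalabanImbrieJaffe1988, (4.3) p.286] -/
def Regular286 {γ : Type*} (cube : Balaban1983to89.Site P j → γ) (G : Set γ) (ek η c pek rek : ℝ) (u : PBond P j → ℂ) :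
    Prop :=
  ∀ g ∈ G, Smooth43 ek η c pek rek (cubeSites cube g) (starB (cubeSites cube g)) (starP (cubeSites cube g)) u

/-- No cubes, no condition. [cite: BalabanImbrieJaffe1988, (4.3) p.286] -/
theorem regular286_empty {γ : Type*} (cube : Balaban1983to89.Site P j → γ) (ek η c pek rek : ℝ) (u : PBond P j → ℂ) :
    Regular286 cube (∅ : Set γ) ek η c pek rek u := fun _ hg => hg.elim

/-- The condition is monotone in the family of cubes. [cite: BalabanImbrieJaffe1988, (4.3) p.286] -/
theorem regular286_mono {γ : Type*} {cube : Balaban1983to89.Site P j → γ} {G G' : Set γ} (hG : G' ⊆ G) {ek η c pek rek : ℝ}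
    {u : PBond P j → ℂ} (h : Regular286 cube G ek η c pek rek u) : Regular286 cube G' ek η c pek rek u :=
  fun g hg => h g (hG hg)

/-- The condition on a union of two families of cubes is the conjunction — how p. 286 splits the check into the cubes meeting
`Λ̄₁^{(k)*c}` (settled by (4.3)) and the others (settled by (5.6.3)–(5.6.5)). [cite: BalabanImbrieJaffe1988, (4.3) p.286] -/
theorem regular286_union {γ : Type*} {cube : Balaban1983to89.Site P j → γ} {G G' : Set γ} {ek η c pek rek : ℝ}
    {u : PBond P j → ℂ} : Regular286 cube (G ∪ G') ek η c pek rek u ↔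
      Regular286 cube G ek η c pek rek u ∧ Regular286 cube G' ek η c pek rek u :=
  ⟨fun h => ⟨regular286_mono Set.subset_union_left h, regular286_mono Set.subset_union_right h⟩,
    fun h g hg => hg.elim (h.1 g) (h.2 g)⟩

/-- **p. 286, PROVED:** *"In Λ̄₁^{(k)*c} we have ũ_{k+1} = u_k, so the condition follows from the induction hypothesis (4.3)."* —
on every family `G` of cubes on whose bonds the modified background `ũ` agrees with `u_k`, the regularity condition for `u_k`
(the induction hypothesis (4.3)) gives the regularity condition for `ũ`, with the same constants.
[cite: BalabanImbrieJaffe1988, (4.3) p.286] -/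
theorem regular286_of_eqOn {γ : Type*} {cube : Balaban1983to89.Site P j → γ} {G : Set γ} {ek η c pek rek : ℝ}
    {uk utilde : PBond P j → ℂ} (heq : ∀ g ∈ G, ∀ b ∈ starB (cubeSites cube g), utilde b = uk b)
    (h43 : Regular286 cube G ek η c pek rek uk) : Regular286 cube G ek η c pek rek utilde :=
  fun g hg => (smooth43_congr (heq g hg)).2 (h43 g hg)

/-- **p. 286, PROVED:** *"The gauge transformation does not change the regularity"* — `u^μ` satisfies the regularity condition on
a family of cubes iff `u` does. [cite: BalabanImbrieJaffe1988, (4.3) p.286] -/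
theorem regular286_gaugeU_iff {γ : Type*} (cube : Balaban1983to89.Site P j → γ) (G : Set γ) (ek η c pek rek : ℝ)
    (mu : Balaban1983to89.Site P j → ℝ) (u : PBond P j → ℂ) :
    Regular286 cube G ek η c pek rek (gaugeU mu u) ↔ Regular286 cube G ek η c pek rek u :=
  forall₂_congr fun _ _ => smooth43_gaugeU_iff ek η c pek rek _ _ _ mu u

/-- The two steps together, as p. 286 uses them for the part of `ũ_{k+1}` outside `Λ̄₁^{(k)*}`: if `ũ` agrees on the cubes of `G`
with a GAUGE TRANSFORM of `u_k` (the deleted factor *"Q^{s*}_k e^{ie_k∂λ} is a gauge transformation"*), the induction hypothesis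
for `u_k` still yields the condition for `ũ`. [cite: BalabanImbrieJaffe1988, (4.3) p.286] -/
theorem regular286_of_eqOn_gaugeU {γ : Type*} {cube : Balaban1983to89.Site P j → γ} {G : Set γ} {ek η c pek rek : ℝ}
    {uk utilde : PBond P j → ℂ} (mu : Balaban1983to89.Site P j → ℝ)
    (heq : ∀ g ∈ G, ∀ b ∈ starB (cubeSites cube g), utilde b = gaugeU mu uk b)
    (h43 : Regular286 cube G ek η c pek rek uk) : Regular286 cube G ek η c pek rek utilde :=
  regular286_of_eqOn heq ((regular286_gaugeU_iff cube G ek η c pek rek mu uk).2 h43)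

/-- Monotonicity in the constant, cube family version (`p(e_k), r(e_k) ≥ 0`). [cite: BalabanImbrieJaffe1988, (4.3) p.286] -/
theorem regular286_mono_const {γ : Type*} {cube : Balaban1983to89.Site P j → γ} {G : Set γ} {ek η c c' pek rek : ℝ}
    (hc : c ≤ c') (hp : 0 ≤ pek) (hr : 0 ≤ rek) {u : PBond P j → ℂ} (h : Regular286 cube G ek η c pek rek u) :
    Regular286 cube G ek η c' pek rek u :=
  fun g hg => smooth43_mono hc hp hr (h g hg)

/-! ## Non-vacuity: the trivial background is regular -/

/-- The constant field `u ≡ 1` satisfies (4.3) on every cube with `A^λ = 0`, `λ = 0`, for any `c·p·r ≥ 0` (witness that the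
typed condition is inhabited; not a statement of the paper beyond (4.3)'s form). [cite: BalabanImbrieJaffe1988, (4.3) p.274] -/
theorem smooth43_one {ej ζ c pej rej : ℝ} (hcpr : 0 ≤ c * pej * rej) (X : Finset (Balaban1983to89.Site P j))
    (B : Finset (PBond P j)) (Pl : Finset (Plaq P j)) : Smooth43 ej ζ c pej rej X B Pl (fun _ => (1 : ℂ)) := by
  refine ⟨fun _ => 0, 0, fun b _ => ?_, fun b _ => ?_, fun p _ => ?_, fun x _ => ?_⟩
  · simp [gaugeU]
  · simpa using hcpr
  · simpa [LatticeFieldCalculus.curl] using hcpr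
  · simpa [LatticeFieldCalculus.diverg] using hcpr

/-- Hence `u ≡ 1` satisfies the regularity condition of p. 286 on every family of cubes. [cite: BalabanImbrieJaffe1988, (4.3) p.286] -/
theorem regular286_one {γ : Type*} (cube : Balaban1983to89.Site P j → γ) (G : Set γ) {ek η c pek rek : ℝ}
    (hcpr : 0 ≤ c * pek * rek) : Regular286 cube G ek η c pek rek (fun _ => (1 : ℂ)) :=
  fun _ _ => smooth43_one hcpr _ _ _

end

end Literature.MathematicalPhysics.QuantumFieldTheory.BalabanImbrieJaffe1984to88.BIJ88Regularity286
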